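import Literature.MathematicalPhysics.QuantumFieldTheory.Balaban1983to89.T4MultilevelCombGauge

/-!
# `Balaban1983to89.T4MultilevelCombRegular` — the multilevel relative comb-gauge bound with a constant UNIFORM IN THE
# NUMBER OF LEVELS `k` (and bounded uniformly in the blocking factor `L`) under finest-scale regularity `‖U(∂p) − 1‖ ≤ a·η²`

CITATION HEADER (lean-in-tree rule 2026-08-18).  Kernel certificate, on the CONCRETE `ℤ^d` carriers of `T4RelativeComb`
(`Cfg d R = (ℤ^d → Fin d → Rˣ)`, `R` any normed ring), of the `k`-UNIFORM form of this lineage's multilevel bound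
`T4MultilevelCombGauge.multilevel_bound(_global)` (audit cell `pub-balaban`, T4-DAG v19 carved rows `T4-O3.E-NE1′-OG1′-RESID°` /
`-LATTICE*`; self-row `T4-O3.E-NE1′-OG1′-MULTILEVEL-REG*` of unit `b2b-balaban-pv04` gen 16, successor of gen 15's
`-MULTILEVEL*`).
§1 ARITHMETIC: for the UNIFORM list of scales `[L, …, L]` (`k` entries) the accumulated constant `scaleSum` of
`T4MultilevelCombGauge` in closed form (`scaleSum_replicate`: `crossConst d L · Σ_{j<k} c j`; the level-`j` coarse
configuration is `scaled (L^j) U`, `prod_take_replicate`), the division-free geometric identity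
`(Σ_{j<k} L^{2j})·(L² − 1) = L^{2k} − 1` (`geom_sum_sq_mul`) with its corollaries, and the `L`-FREE bound on the constant
`crossConst d L/(L² − 1) ≤ (d − 1)(2d − 1)` (`crossConst_div_le`; the slack is the identity
`(d−1)(2d−1)(L²−1) − crossConst d L = (d−1)(L−1)(4d+L−4)`, `crossConst_slack`), `2(d−1)(2d−1) ≤ 4d²`.
§2 THE MULTILEVEL BOUND ON A UNIFORM SCALE LIST (`multilevel_bound_replicate`, `L ≥ 1`): for a unitary-like pair with
finest curvature sups `q₁, q₀`, on EVERY bond of `ℤ^d`,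
`‖(U₁^g)(b)·U₀(b)⁻¹ − 1‖ ≤ crossConst d L·(Σ_{j<k} L^{2j})·(q₁ + q₀) + X`, `g = multiComb (replicate k L) hTop U₀ U₁`, `X` the
free top-level relative deviation in the top gauge `hTop` (the coarsest pair is `scaled (L^k) Uᵢ`).
§3 REGULARITY ⇒ A `k`-UNIFORM CONSTANT: the finest-scale hypothesis `FineRegular L k a U`: `‖U(∂p) − 1‖ ≤ a/L^{2k} = a·η²`,
`η = L^{−k}`, on every plaquette (the (52)/(1.7)-at-the-innermost-domain TYPE, see PRINTED STATUS), and the per-level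
hypothesis `LevelRegular L k a U`: `‖(scaled (L^j) U)(∂p′) − 1‖ ≤ a·L^{2j}/L^{2k} = a·(L^jη)²` for `j < k` (the (53) TYPE;
`levelRegular_of_fineRegular` = non-abelian Stokes BY NAME, `T4MultilevelCombGauge.norm_plaq_scaled_sub_one_le`); THE BOUNDS
(`L ≥ 2`): `multilevel_bound_levelRegular` / `multilevel_bound_regular`
`‖(U₁^g)(b)·U₀(b)⁻¹ − 1‖ ≤ crossConst d L/(L² − 1)·(a₁ + a₀) + X` — NO `k` on the right-hand side — and the `L`-free forms
`multilevel_bound_regular_dconst` `≤ (d−1)(2d−1)·(a₁ + a₀) + X`, `multilevel_bound_regular_four_d_sq` (one `a` for both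
configurations) `≤ 4d²·a + X`.
§4 THE FIBRE COROLLARY (`same_top_bound`, `same_top_bound_dconst`): if the two `k`-fold coarse configurations COINCIDE,
`scaled (L^k) U₁ = scaled (L^k) U₀`, then with the trivial top gauge `X = 0`, so two finest-scale-regular configurations in
the same fibre of the `k`-fold straight-transport blocking map are `(d−1)(2d−1)(a₁ + a₀)`-close bond-wise in the multilevel
relative comb gauge — for EVERY `k` and every `L ≥ 2`.  §5 non-vacuity / sanity (`d = 4`: the constant is
`(d−1)(2d−1) = 21`, `2·21 ≤ 4d² = 64`, `crossConst 4 2/(2² − 1) = 7`; three levels at `L = 2`; the flat configuration is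
`FineRegular`/`LevelRegular` with `a = 0`; the fibre bound on the flat pair; the `k`-uniformity displayed against the flat
reference).

PRINTED STATUS.  NOTHING printed enters any declaration; every declaration is [folklore] = the cell's own corollary of
`multilevel_bound(_global)` and a geometric series, kernel-proved.  The cell's literature record `t4/CITED-FACTS-T4.md` v1.11
entry F-T4-66 states under NOT-FOR: «a k-step / multi-scale version with constants uniform in k (not printed here — the
k-level gauge Ax_k is defined (1.19) but Lemma 1 is k = 1)»; this file is that cell-side version for the lineage's objects.
CONTEXT ONLY — the printed statements whose TYPE the hypotheses and the mechanism follow, quoted VERBATIM from the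
render-read entries of `t4/CITED-FACTS-T4.md` v1.11 (F-T4-61, -65, -66, -74, -127) and re-checked by this seat on the x2
renders `b2b-balaban-ref1/pages/1985-cmp99-regular-spaces-gauge-fixing/…-p003-x2.png, -p005-x2.png, -p006-x2.png` (journal
pp. 77, 79, 80; PDF page = journal page − 74) and `…/1985-cmp98-averaging/…-p010-x2.png, -p029-x2.png` (journal pp. 26, 45;
PDF page = journal page − 16), read as images:
(α) the regular spaces, [Balaban1985RegularSpaces] (T. Bałaban, "Spaces of Regular Gauge Field Configurations on a Lattice
and Gauge Fixing Conditions", CMP 99 (1985) 75–102) p. 77 (1.7)/(1.8): «for a sequence (1.3) and a positive number α₀ we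
define 𝔘_k({Ω_j}, α₀) as a set of all gauge field configurations U on T_η satisfying the conditions |U(∂p) − 1| < α₀L^{−2j}
for p ∈ Ω_j, j = 0, 1, …, k, (1.7) or |U(∂p) − 1| < α₀η²(L^jη)^{−2} for p ⊂ Ω_j, (1.8)» and «Let us notice that we admit
the case where some domains Ω_j are equal to T_η» (here: `FineRegular L k a U` is the whole-lattice case at the innermost
index `j = k`, `α₀L^{−2k} = α₀η²`, with `≤` for print's `<`, on `ℤ^d`; the same hypothesis is [Balaban1985Averaging]
(T. Bałaban, "Averaging Operations for Lattice Gauge Theories", CMP 98 (1985) 17–51) p. 26 (52): «To get some small number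
yet, we have to assume that |U(∂p) − 1| < α₀η², η = L^{−k} (52) on some set of plaquettes.»);  (β) the per-level law for
AVERAGES, [Balaban1985Averaging] p. 26: «Each averaging operation rescales a bound on plaquette variables approximately by
the factor L², hence k operations by the factor L^{2k}.» and the inductive bound (53) «|Ū^j(∂p) − 1| < α₀L^{2j}η² +
C₀(α₀L^{2j}η²)²·[1 + L^{−2}(1 + C₀α₀)² + … + L^{−2(j−1)}(1 + C₀α₀)^{2(j−1)}]. (53) The right-hand side can be bounded by
α₀ + C₀α₀²2 if L^{−2}(1 + C₀α₀)² < ½.» (here: `LevelRegular` is the TYPE `a·L^{2j}η²` for the straight transports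
`scaled (L^j) U`, where it is EXACTLY `(L^j)²`-Stokes with no correction term; and the printed MECHANISM for `k`-uniform
constants — a geometric series in `L^{−2}` bounded independently of the number of levels — is the one used in §1/§3, cf. also
p. 45 (173) «|r_j(x_j)| < C₃(α₃L^jη)²[1 + L^{−2}(1 + C₃α₃)² + … + (L^{−2}(1 + C₃α₃)²)^{j−1}] < 2C₃(α₃L^jη)²»);  (γ) the
printed TWO-CONFIGURATION bound this generalises in `k`, [Balaban1985RegularSpaces] p. 79 Lemma 1: «Let V₀, V′V₀ satisfy the
condition (1.7) for k = 1 and L arbitrary, and let (R(V₀)V′)(Γ_{y,x}) = 1 for x ∈ B(y), |\overline{V′V₀} − V̄₀| < α₁ on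
Ω₁^{(1)}. (1.24) Then for α₀, α₁ small the configuration V′ is also small, more precisely we have the bound |V′ − 1| < 4d²α₀
+ α₁ on Ω₁. (1.25) We will prove the lemma. From (1.22) and the assumptions we have |(∂_{V₀}V′)(p) − 1| ≤ |V₀(∂p) − 1| +
|(V′V₀)(∂p) − 1| < 2α₀L^{−2}. (1.26)» and p. 80: «hence finally we have the bound (1.25) for an arbitrary bond b. From this
proof it follows that the result is local in the sense that the bound (1.25) for a bond b depends on bounds (1.7), (1.24)
on B(c₋)∪B(c₊), if b belongs to this set. The bound (1.25) holds for arbitrary L, unfortunately for L large it is too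
weak.» (here: `k` levels instead of one, the constant `(d−1)(2d−1)·(a₁ + a₀)` resp. `4d²·a` independent of `k` AND `L`; the
rôle of print's `α₁` — closeness of the AVERAGES, hypothesis (1.24) — is played by the free top deviation `X` of the
straight-transport coarse pair in the top gauge, which nothing here bounds; §4 is the case `X = 0`).  No cited-fact
binder, no summit-side statement.  The cite tags below are the imported files'.

HONEST SCOPE.  (i) Sup norms, unitary-like pairs and unitary-like gauges only; `ℤ^d` as the whole lattice (no nested
domains `Ω_j`, no torus), so print's LOCALITY remark is not typed.  (ii) The coarse variables are the STRAIGHT transports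
`scaled (L^j) U` (= `T4BlockTransport.blockCfg`), not Bałaban's averages `Ū^j`; the top gauge `hTop` and the top deviation
`X` are free inputs (print fixes the former by (61)/(81) and bounds the analogue of the latter by (1.24)).  (iii) `L ≥ 2`
for the closed forms (`L ≥ 1` for the `Σ` form of §2); uniform blocking factor only (`List.replicate k L`).  (iv) The
constant `(d−1)(2d−1)` is the lineage's `crossConst` bookkeeping divided by `L² − 1`, not an optimisation; print's own
verdict «for L large it is too weak» concerns the USE of an `O(α₀)` (not `O(α₀L^{−1})`-type) bound downstream and applies
verbatim to this file.  (v) NO statement about averaging operations, Hölder norms, windows, Landau gauge or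
renormalization transformations.  Value = kernel bookkeeping (a geometric series on top of `multilevel_bound`); NOT summit
progress.
-/

namespace Literature.MathematicalPhysics.QuantumFieldTheory.Balaban1983to89.T4MultilevelCombRegular

open Finset
open T4RelativeLadder (UnitaryLike)
open T4RelativeComb (Cfg gaugeAct plaq)
open T4RelativeCombCrossing (pert crossConst interiorConst_nonneg interiorConst_le_crossConst)
open T4MultilevelCombGauge (scaled scaled_one multiComb scaleSum multilevel_bound multilevel_bound_global
  norm_plaq_scaled_sub_one_le unitaryLike_scaled hol_line_eq_one)

variable {R : Type*} [NormedRing R] {d : ℕ}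

/-- [folklore] Local shorthand for the site lattice `ℤ^d` (the carrier of `T4MultilevelCombGauge.Site d`, definitionally). -/
abbrev Site (d : ℕ) : Type := Fin d → ℤ

example (d : ℕ) : Site d = T4MultilevelCombGauge.Site d := rfl

/-! ## §1  Arithmetic: `scaleSum` on a uniform list, the geometric series, the `L`-free constant -/

/-- [folklore] On the uniform list `[L, …, L]` (`k` entries) the accumulated constant is `crossConst d L · Σ_{j<k} c j`. -/
theorem scaleSum_replicate (d L : ℕ) :
    ∀ (k : ℕ) (c : ℕ → ℝ), scaleSum d (List.replicate k L) c = crossConst d L * ∑ j ∈ range k, c j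
  | 0, c => by simp [scaleSum]
  | k + 1, c => by
      rw [List.replicate_succ]
      show crossConst d L * c 0 + scaleSum d (List.replicate k L) (fun j => c (j + 1)) = _
      rw [scaleSum_replicate d L k, Finset.sum_range_succ' c k]
      ring

/-- [folklore] The level-`j` product of scales of the uniform list is `L^j` (`j ≤ k`). -/
theorem prod_take_replicate (L : ℕ) {k j : ℕ} (hj : j ≤ k) : ((List.replicate k L).take j).prod = L ^ j := by
  rw [List.take_replicate, min_eq_left hj, List.prod_replicate]

/-- [folklore] Every scale of the uniform list is `≥ 1` if `L ≥ 1`. -/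
theorem one_le_of_mem_replicate {L k L' : ℕ} (hL : 1 ≤ L) (h : L' ∈ List.replicate k L) : 1 ≤ L' := by
  rw [List.eq_of_mem_replicate h]; exact hL

/-- [folklore] THE GEOMETRIC SERIES, division-free: `(Σ_{j<k} L^{2j})·(L² − 1) = L^{2k} − 1`. -/
theorem geom_sum_sq_mul (L : ℝ) (k : ℕ) : (∑ j ∈ range k, (L ^ j) ^ 2) * (L ^ 2 - 1) = (L ^ k) ^ 2 - 1 := by
  have h : ∀ j : ℕ, (L ^ j) ^ 2 = (L ^ 2) ^ j := fun j => by ring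
  simp_rw [h]
  exact geom_sum_mul (L ^ 2) k

/-- [folklore] `Σ_{j<k} L^{2j} = (L^{2k} − 1)/(L² − 1)` for `L² ≠ 1`. -/
theorem geom_sum_sq_eq {L : ℝ} (hL : L ^ 2 ≠ 1) (k : ℕ) :
    ∑ j ∈ range k, (L ^ j) ^ 2 = ((L ^ k) ^ 2 - 1) / (L ^ 2 - 1) := by
  rw [eq_div_iff (sub_ne_zero.2 hL)]
  exact geom_sum_sq_mul L k

/-- [folklore] `Σ_{j<k} L^{2j} ≤ L^{2k}/(L² − 1)` for `L² > 1`: the top term dominates, uniformly in `k`. -/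
theorem geom_sum_sq_le {L : ℝ} (hL : 1 < L ^ 2) (k : ℕ) :
    ∑ j ∈ range k, (L ^ j) ^ 2 ≤ (L ^ k) ^ 2 / (L ^ 2 - 1) := by
  rw [le_div_iff₀ (sub_pos.2 hL), geom_sum_sq_mul]
  linarith

/-- [folklore] `0 ≤ crossConst d L` for `d, L ≥ 1`. -/
theorem crossConst_nonneg {d L : ℕ} (hd : 1 ≤ d) (hL : 1 ≤ L) : 0 ≤ crossConst d L :=
  (interiorConst_nonneg hd hL).trans (interiorConst_le_crossConst hd hL)

/-- [folklore] THE SLACK IDENTITY `(d−1)(2d−1)(L²−1) − crossConst d L = (d−1)(L−1)(4d+L−4)`. -/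
theorem crossConst_slack (d L : ℕ) :
    ((d : ℝ) - 1) * (2 * (d : ℝ) - 1) * ((L : ℝ) ^ 2 - 1) - crossConst d L =
      ((d : ℝ) - 1) * ((L : ℝ) - 1) * (4 * (d : ℝ) + (L : ℝ) - 4) := by
  unfold crossConst; ring

/-- [folklore] `crossConst d L ≤ (d−1)(2d−1)·(L² − 1)` for `d, L ≥ 1`. -/
theorem crossConst_le {d L : ℕ} (hd : 1 ≤ d) (hL : 1 ≤ L) :
    crossConst d L ≤ ((d : ℝ) - 1) * (2 * (d : ℝ) - 1) * ((L : ℝ) ^ 2 - 1) := by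
  have h1 : (1 : ℝ) ≤ d := by exact_mod_cast hd
  have h2 : (1 : ℝ) ≤ L := by exact_mod_cast hL
  have hs := crossConst_slack d L
  have h0 : 0 ≤ ((d : ℝ) - 1) * ((L : ℝ) - 1) * (4 * (d : ℝ) + (L : ℝ) - 4) :=
    mul_nonneg (mul_nonneg (by linarith) (by linarith)) (by linarith)
  linarith

/-- [folklore] THE `L`-FREE CONSTANT: `crossConst d L/(L² − 1) ≤ (d−1)(2d−1)` for `d ≥ 1`, `L ≥ 2`. -/
theorem crossConst_div_le {d L : ℕ} (hd : 1 ≤ d) (hL : 2 ≤ L) :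
    crossConst d L / ((L : ℝ) ^ 2 - 1) ≤ ((d : ℝ) - 1) * (2 * (d : ℝ) - 1) := by
  have h2 : (2 : ℝ) ≤ L := by exact_mod_cast hL
  have hpos : 0 < (L : ℝ) ^ 2 - 1 := by nlinarith
  rw [div_le_iff₀ hpos]
  exact crossConst_le hd (by omega)

/-- [folklore] `2(d−1)(2d−1) ≤ 4d²` (`d ≥ 1`): one `a` for both configurations gives a constant of print's (1.25) shape. -/
theorem two_mul_dconst_le {d : ℕ} (hd : 1 ≤ d) : 2 * (((d : ℝ) - 1) * (2 * (d : ℝ) - 1)) ≤ 4 * (d : ℝ) ^ 2 := by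
  have h1 : (1 : ℝ) ≤ d := by exact_mod_cast hd
  nlinarith

/-! ## §2  The multilevel bound on the uniform scale list `[L, …, L]` -/

/-- [folklore] **THE MULTILEVEL BOUND, UNIFORM SCALE LIST, `Σ` FORM**: for a unitary-like pair `(U₀, U₁)` on `ℤ^d` with
finest curvature sups `q₁, q₀`, blocking factor `L ≥ 1`, `k` levels, a unitary-like top gauge `hTop` and `X` bounding the
relative deviation of the top pair `(scaled (L^k) U₀, (scaled (L^k) U₁)^{hTop})`, on EVERY bond
`‖(U₁^g)(b)·U₀(b)⁻¹ − 1‖ ≤ crossConst d L·(Σ_{j<k} L^{2j})·(q₁ + q₀) + X` (`multilevel_bound_global` + `scaleSum_replicate`). -/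
theorem multilevel_bound_replicate [NormOneClass R] (L k : ℕ) {U₀ U₁ : Cfg d R} {hTop : Site d → Rˣ} {q₁ q₀ X : ℝ}
    (hU₀ : ∀ x ν, UnitaryLike (U₀ x ν)) (hU₁ : ∀ x ν, UnitaryLike (U₁ x ν)) (hh : ∀ x, UnitaryLike (hTop x))
    (hL : 1 ≤ L) (hq₁ : ∀ x ρ κ, ρ ≠ κ → ‖(plaq U₁ x ρ κ : R) - 1‖ ≤ q₁)
    (hq₀ : ∀ x ρ κ, ρ ≠ κ → ‖(plaq U₀ x ρ κ : R) - 1‖ ≤ q₀) (hq : 0 ≤ q₁ + q₀)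
    (hX : ∀ z ν, ‖(pert (scaled (L ^ k) U₀) (gaugeAct hTop (scaled (L ^ k) U₁)) z ν : R) - 1‖ ≤ X)
    (x : Site d) (ν : Fin d) :
    ‖(pert U₀ (gaugeAct (multiComb (List.replicate k L) hTop U₀ U₁) U₁) x ν : R) - 1‖ ≤
      crossConst d L * (∑ j ∈ range k, ((L : ℝ) ^ j) ^ 2) * (q₁ + q₀) + X := by
  have hLs : ∀ L' ∈ List.replicate k L, 1 ≤ L' := fun L' h => one_le_of_mem_replicate hL h
  have hX' : ∀ z ν, ‖(pert (scaled (List.replicate k L).prod U₀)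
      (gaugeAct hTop (scaled (List.replicate k L).prod U₁)) z ν : R) - 1‖ ≤ X := by
    rw [List.prod_replicate]; exact hX
  have h := multilevel_bound_global (List.replicate k L) hU₀ hU₁ hh hLs hq₁ hq₀ hq hX' x ν
  rw [scaleSum_replicate] at h
  have hsum : ∑ j ∈ range k, ((((List.replicate k L).take j).prod : ℕ) : ℝ) ^ 2 * (q₁ + q₀) =
      (∑ j ∈ range k, ((L : ℝ) ^ j) ^ 2) * (q₁ + q₀) := by
    rw [Finset.sum_mul]
    refine Finset.sum_congr rfl fun j hj => ?_
    rw [prod_take_replicate L (Finset.mem_range.1 hj).le]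
    push_cast; ring
  rw [hsum, ← mul_assoc] at h
  exact h

/-! ## §3  Finest-scale / per-level regularity of (52), (1.7), (53) TYPE, and the `k`-uniform bound -/

/-- [folklore] FINEST-SCALE REGULARITY (TYPE of (52) / (1.7) at the innermost index, whole lattice): every plaquette of `U`
has `‖U(∂p) − 1‖ ≤ a/L^{2k} = a·η²`, `η = L^{−k}` (print: strict `<`, G-valued `U` on `T_η`; here `≤`, any `U`, `ℤ^d`). -/
def FineRegular (L k : ℕ) (a : ℝ) (U : Cfg d R) : Prop :=
  ∀ x ρ κ, ρ ≠ κ → ‖(plaq U x ρ κ : R) - 1‖ ≤ a / ((L : ℝ) ^ k) ^ 2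

/-- [folklore] PER-LEVEL REGULARITY (TYPE of (53), for the straight-transport coarse configurations): for every level
`j < k` every plaquette of `scaled (L^j) U` has `‖(scaled (L^j) U)(∂p′) − 1‖ ≤ a·L^{2j}/L^{2k} = a·(L^jη)²`. -/
def LevelRegular (L k : ℕ) (a : ℝ) (U : Cfg d R) : Prop :=
  ∀ j, j < k → ∀ x ρ κ, ρ ≠ κ →
    ‖(plaq (scaled (L ^ j) U) x ρ κ : R) - 1‖ ≤ a * ((L : ℝ) ^ j) ^ 2 / ((L : ℝ) ^ k) ^ 2

/-- [folklore] Finest-scale regularity implies per-level regularity with the SAME `a` (non-abelian Stokes on the `L^j × L^j`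
square, `T4MultilevelCombGauge.norm_plaq_scaled_sub_one_le`, BY NAME) — for straight transports the `L^{2j}` law is exact. -/
theorem levelRegular_of_fineRegular [NormOneClass R] {U : Cfg d R} (hU : ∀ x ν, UnitaryLike (U x ν)) {L k : ℕ} {a : ℝ}
    (ha : FineRegular L k a U) : LevelRegular L k a U := by
  intro j _ x ρ κ hρκ
  have h := norm_plaq_scaled_sub_one_le hU ha (L := L ^ j) x ρ κ hρκ
  calc _ ≤ _ := h
    _ = a * ((L : ℝ) ^ j) ^ 2 / ((L : ℝ) ^ k) ^ 2 := by push_cast; ring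

/-- [folklore] Monotonicity in the constant. -/
theorem FineRegular.mono {L k : ℕ} {a a' : ℝ} {U : Cfg d R} (h : FineRegular L k a U) (haa' : a ≤ a') :
    FineRegular L k a' U := fun x ρ κ hρκ =>
  (h x ρ κ hρκ).trans (div_le_div_of_nonneg_right haa' (sq_nonneg _))

/-- [folklore] A regular configuration's constant is `≥ 0` as soon as there are two directions (`L ≥ 1`). -/
theorem FineRegular.nonneg {L k : ℕ} {a : ℝ} {U : Cfg d R} (h : FineRegular L k a U) (hL : 1 ≤ L) {ρ κ : Fin d}
    (hρκ : ρ ≠ κ) : 0 ≤ a := by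
  have hLk : 0 < ((L : ℝ) ^ k) ^ 2 := by
    have : (1 : ℝ) ≤ L := by exact_mod_cast hL
    positivity
  have h0 := (norm_nonneg _).trans (h (fun _ => 0) ρ κ hρκ)
  exact (div_nonneg_iff.1 h0).elim (fun h => h.1) fun h => absurd h.2 (not_le.2 hLk)

/-- [folklore] **THE `k`-UNIFORM MULTILEVEL BOUND, PER-LEVEL HYPOTHESES** (`L ≥ 2`): for a unitary-like pair with
`LevelRegular L k aᵢ Uᵢ` (`i = 0, 1`), a unitary-like top gauge and `X` bounding the top relative deviation, on EVERY bond
`‖(U₁^g)(b)·U₀(b)⁻¹ − 1‖ ≤ crossConst d L/(L² − 1)·(a₁ + a₀) + X`, `g = multiComb (replicate k L) hTop U₀ U₁` — the right-hand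
side does not depend on `k` (`multilevel_bound` with `qᵢ⁽ʲ⁾ = aᵢ·L^{2j}/L^{2k}`, `geom_sum_sq_le`). -/
theorem multilevel_bound_levelRegular [NormOneClass R] {L : ℕ} (k : ℕ) {U₀ U₁ : Cfg d R} {hTop : Site d → Rˣ}
    {a₁ a₀ X : ℝ} (hU₀ : ∀ x ν, UnitaryLike (U₀ x ν)) (hU₁ : ∀ x ν, UnitaryLike (U₁ x ν))
    (hh : ∀ x, UnitaryLike (hTop x)) (hL : 2 ≤ L) (ha₁ : LevelRegular L k a₁ U₁) (ha₀ : LevelRegular L k a₀ U₀)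
    (ha : 0 ≤ a₁ + a₀)
    (hX : ∀ z ν, ‖(pert (scaled (L ^ k) U₀) (gaugeAct hTop (scaled (L ^ k) U₁)) z ν : R) - 1‖ ≤ X)
    (x : Site d) (ν : Fin d) :
    ‖(pert U₀ (gaugeAct (multiComb (List.replicate k L) hTop U₀ U₁) U₁) x ν : R) - 1‖ ≤
      crossConst d L / ((L : ℝ) ^ 2 - 1) * (a₁ + a₀) + X := by
  have hd : 1 ≤ d := by have := ν.isLt; omega
  have hL1 : 1 ≤ L := by omega
  have hLr : (2 : ℝ) ≤ L := by exact_mod_cast hL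
  have hLk : 0 < ((L : ℝ) ^ k) ^ 2 := by positivity
  have hpos : 0 < (L : ℝ) ^ 2 - 1 := by nlinarith
  have hLs : ∀ L' ∈ List.replicate k L, 1 ≤ L' := fun L' h => one_le_of_mem_replicate hL1 h
  -- the four hypotheses of `multilevel_bound` on the uniform list
  have hq₁ : ∀ j, j < (List.replicate k L).length → ∀ y ρ κ, ρ ≠ κ →
      ‖(plaq (scaled ((List.replicate k L).take j).prod U₁) y ρ κ : R) - 1‖ ≤
        (fun j => a₁ * ((L : ℝ) ^ j) ^ 2 / ((L : ℝ) ^ k) ^ 2) j := by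
    intro j hj y ρ κ hρκ
    rw [List.length_replicate] at hj
    rw [prod_take_replicate L hj.le]
    exact ha₁ j hj y ρ κ hρκ
  have hq₀ : ∀ j, j < (List.replicate k L).length → ∀ y ρ κ, ρ ≠ κ →
      ‖(plaq (scaled ((List.replicate k L).take j).prod U₀) y ρ κ : R) - 1‖ ≤
        (fun j => a₀ * ((L : ℝ) ^ j) ^ 2 / ((L : ℝ) ^ k) ^ 2) j := by
    intro j hj y ρ κ hρκ
    rw [List.length_replicate] at hj
    rw [prod_take_replicate L hj.le]
    exact ha₀ j hj y ρ κ hρκ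
  have hq : ∀ j, j < (List.replicate k L).length →
      0 ≤ (fun j => a₁ * ((L : ℝ) ^ j) ^ 2 / ((L : ℝ) ^ k) ^ 2) j +
        (fun j => a₀ * ((L : ℝ) ^ j) ^ 2 / ((L : ℝ) ^ k) ^ 2) j := by
    intro j _
    have e : a₁ * ((L : ℝ) ^ j) ^ 2 / ((L : ℝ) ^ k) ^ 2 + a₀ * ((L : ℝ) ^ j) ^ 2 / ((L : ℝ) ^ k) ^ 2 =
        (a₁ + a₀) * (((L : ℝ) ^ j) ^ 2 / ((L : ℝ) ^ k) ^ 2) := by ring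
    show 0 ≤ a₁ * ((L : ℝ) ^ j) ^ 2 / ((L : ℝ) ^ k) ^ 2 + a₀ * ((L : ℝ) ^ j) ^ 2 / ((L : ℝ) ^ k) ^ 2
    rw [e]; exact mul_nonneg ha (by positivity)
  have hX' : ∀ z ν, ‖(pert (scaled (List.replicate k L).prod U₀)
      (gaugeAct hTop (scaled (List.replicate k L).prod U₁)) z ν : R) - 1‖ ≤ X := by
    rw [List.prod_replicate]; exact hX
  have h := multilevel_bound (List.replicate k L) hU₀ hU₁ hh hLs hq₁ hq₀ hq hX' x ν
  rw [scaleSum_replicate] at h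
  have hsum : ∑ j ∈ range k, (a₁ * ((L : ℝ) ^ j) ^ 2 / ((L : ℝ) ^ k) ^ 2 + a₀ * ((L : ℝ) ^ j) ^ 2 / ((L : ℝ) ^ k) ^ 2)
      = (∑ j ∈ range k, ((L : ℝ) ^ j) ^ 2) * ((a₁ + a₀) / ((L : ℝ) ^ k) ^ 2) := by
    rw [Finset.sum_mul]
    refine Finset.sum_congr rfl fun j _ => ?_
    ring
  rw [hsum] at h
  -- the geometric series: crossConst·(Σ L^{2j})·((a₁+a₀)/L^{2k}) ≤ crossConst/(L²−1)·(a₁+a₀)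
  have hC := crossConst_nonneg hd hL1
  have hgeom := geom_sum_sq_le (by nlinarith : (1 : ℝ) < (L : ℝ) ^ 2) k
  have hP : ((L : ℝ) ^ k) ^ 2 ≠ 0 := ne_of_gt hLk
  have hM : (L : ℝ) ^ 2 - 1 ≠ 0 := ne_of_gt hpos
  have key : crossConst d L * ((∑ j ∈ range k, ((L : ℝ) ^ j) ^ 2) * ((a₁ + a₀) / ((L : ℝ) ^ k) ^ 2)) ≤
      crossConst d L / ((L : ℝ) ^ 2 - 1) * (a₁ + a₀) :=
    calc crossConst d L * ((∑ j ∈ range k, ((L : ℝ) ^ j) ^ 2) * ((a₁ + a₀) / ((L : ℝ) ^ k) ^ 2))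
        ≤ crossConst d L * ((((L : ℝ) ^ k) ^ 2 / ((L : ℝ) ^ 2 - 1)) * ((a₁ + a₀) / ((L : ℝ) ^ k) ^ 2)) :=
          mul_le_mul_of_nonneg_left (mul_le_mul_of_nonneg_right hgeom (div_nonneg ha hLk.le)) hC
      _ = crossConst d L / ((L : ℝ) ^ 2 - 1) * (a₁ + a₀) := by
          field_simp
  linarith

/-- [folklore] **THE `k`-UNIFORM MULTILEVEL BOUND, FINEST-SCALE HYPOTHESES** (`L ≥ 2`): for a unitary-like pair with
`FineRegular L k aᵢ Uᵢ` (`‖Uᵢ(∂p) − 1‖ ≤ aᵢ·η²` on every plaquette, `η = L^{−k}`), on EVERY bond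
`‖(U₁^g)(b)·U₀(b)⁻¹ − 1‖ ≤ crossConst d L/(L² − 1)·(a₁ + a₀) + X` — independent of `k`
(`levelRegular_of_fineRegular` + `multilevel_bound_levelRegular`). -/
theorem multilevel_bound_regular [NormOneClass R] {L : ℕ} (k : ℕ) {U₀ U₁ : Cfg d R} {hTop : Site d → Rˣ}
    {a₁ a₀ X : ℝ} (hU₀ : ∀ x ν, UnitaryLike (U₀ x ν)) (hU₁ : ∀ x ν, UnitaryLike (U₁ x ν))
    (hh : ∀ x, UnitaryLike (hTop x)) (hL : 2 ≤ L) (ha₁ : FineRegular L k a₁ U₁) (ha₀ : FineRegular L k a₀ U₀)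
    (hX : ∀ z ν, ‖(pert (scaled (L ^ k) U₀) (gaugeAct hTop (scaled (L ^ k) U₁)) z ν : R) - 1‖ ≤ X)
    (x : Site d) (ν : Fin d) :
    ‖(pert U₀ (gaugeAct (multiComb (List.replicate k L) hTop U₀ U₁) U₁) x ν : R) - 1‖ ≤
      crossConst d L / ((L : ℝ) ^ 2 - 1) * (a₁ + a₀) + X := by
  rcases Nat.lt_or_ge 1 d with hd | hd
  · -- two distinct directions exist, so the regularity constants are `≥ 0`
    have hρκ : (⟨0, by omega⟩ : Fin d) ≠ ⟨1, hd⟩ := by simp [Fin.ext_iff]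
    have ha : 0 ≤ a₁ + a₀ := add_nonneg (ha₁.nonneg (by omega) hρκ) (ha₀.nonneg (by omega) hρκ)
    exact multilevel_bound_levelRegular k hU₀ hU₁ hh hL (levelRegular_of_fineRegular hU₁ ha₁)
      (levelRegular_of_fineRegular hU₀ ha₀) ha hX x ν
  · -- `d = 1`: no plaquettes, `crossConst 1 L = 0`, and the `Σ` form with the vacuous curvature sups `0` gives `≤ X`
    have hd1 : d = 1 := by have := ν.isLt; omega
    subst hd1
    have hC0 : crossConst 1 L = 0 := by unfold crossConst; simp
    have hvac : ∀ (V : Cfg 1 R) (y : Site 1) (ρ κ : Fin 1), ρ ≠ κ → ‖(plaq V y ρ κ : R) - 1‖ ≤ 0 :=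
      fun V y ρ κ hρκ => absurd (Subsingleton.elim ρ κ) hρκ
    have h := multilevel_bound_replicate L k hU₀ hU₁ hh (by omega) (hvac U₁) (hvac U₀) (by norm_num) hX x ν
    rw [hC0] at h ⊢
    simpa using h

/-- [folklore] **THE `k`- AND `L`-FREE FORM**: under `FineRegular L k aᵢ Uᵢ`, `L ≥ 2`, on EVERY bond
`‖(U₁^g)(b)·U₀(b)⁻¹ − 1‖ ≤ (d−1)(2d−1)·(a₁ + a₀) + X` (`crossConst_div_le`). -/
theorem multilevel_bound_regular_dconst [NormOneClass R] {L : ℕ} (k : ℕ) {U₀ U₁ : Cfg d R} {hTop : Site d → Rˣ}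
    {a₁ a₀ X : ℝ} (hU₀ : ∀ x ν, UnitaryLike (U₀ x ν)) (hU₁ : ∀ x ν, UnitaryLike (U₁ x ν))
    (hh : ∀ x, UnitaryLike (hTop x)) (hL : 2 ≤ L) (ha₁ : FineRegular L k a₁ U₁) (ha₀ : FineRegular L k a₀ U₀)
    (hX : ∀ z ν, ‖(pert (scaled (L ^ k) U₀) (gaugeAct hTop (scaled (L ^ k) U₁)) z ν : R) - 1‖ ≤ X)
    (x : Site d) (ν : Fin d) :
    ‖(pert U₀ (gaugeAct (multiComb (List.replicate k L) hTop U₀ U₁) U₁) x ν : R) - 1‖ ≤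
      ((d : ℝ) - 1) * (2 * (d : ℝ) - 1) * (a₁ + a₀) + X := by
  have h := multilevel_bound_regular k hU₀ hU₁ hh hL ha₁ ha₀ hX x ν
  have hd : 1 ≤ d := by have := ν.isLt; omega
  rcases Nat.lt_or_ge 1 d with hd2 | hd2
  · have hρκ : (⟨0, by omega⟩ : Fin d) ≠ ⟨1, hd2⟩ := by simp [Fin.ext_iff]
    have ha : 0 ≤ a₁ + a₀ := add_nonneg (ha₁.nonneg (by omega) hρκ) (ha₀.nonneg (by omega) hρκ)
    have hc := mul_le_mul_of_nonneg_right (crossConst_div_le hd hL) ha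
    linarith
  · have hd1 : d = 1 := by omega
    subst hd1
    have hC0 : crossConst 1 L = 0 := by unfold crossConst; simp
    rw [hC0] at h
    simpa using h

/-- [folklore] **ONE CONSTANT FOR BOTH CONFIGURATIONS, PRINT'S SHAPE**: if `U₀` and `U₁` are both `FineRegular L k a`
(`a ≥ 0`, as print's `α₀`), then on EVERY bond `‖(U₁^g)(b)·U₀(b)⁻¹ − 1‖ ≤ 4d²·a + X` — for every number of levels `k` and
every `L ≥ 2` (cf. the printed `k = 1` constant «4d²α₀ + α₁» of (1.25), CONTEXT (γ); `two_mul_dconst_le`). -/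
theorem multilevel_bound_regular_four_d_sq [NormOneClass R] {L : ℕ} (k : ℕ) {U₀ U₁ : Cfg d R} {hTop : Site d → Rˣ}
    {a X : ℝ} (hU₀ : ∀ x ν, UnitaryLike (U₀ x ν)) (hU₁ : ∀ x ν, UnitaryLike (U₁ x ν))
    (hh : ∀ x, UnitaryLike (hTop x)) (hL : 2 ≤ L) (ha₁ : FineRegular L k a U₁) (ha₀ : FineRegular L k a U₀) (ha : 0 ≤ a)
    (hX : ∀ z ν, ‖(pert (scaled (L ^ k) U₀) (gaugeAct hTop (scaled (L ^ k) U₁)) z ν : R) - 1‖ ≤ X)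
    (x : Site d) (ν : Fin d) :
    ‖(pert U₀ (gaugeAct (multiComb (List.replicate k L) hTop U₀ U₁) U₁) x ν : R) - 1‖ ≤ 4 * (d : ℝ) ^ 2 * a + X := by
  have h := multilevel_bound_regular_dconst k hU₀ hU₁ hh hL ha₁ ha₀ hX x ν
  have hd : 1 ≤ d := by have := ν.isLt; omega
  have h2 := mul_le_mul_of_nonneg_right (two_mul_dconst_le hd) ha
  nlinarith [h, h2]

/-! ## §4  The fibre corollary: same `k`-fold coarse configuration ⇒ `X = 0` -/

/-- [folklore] In the trivial gauge a configuration has relative deviation `1` against itself: `V(b)·V(b)⁻¹ = 1`. -/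
theorem pert_gaugeAct_one_self (V : Cfg d R) (z : Site d) (ν : Fin d) :
    pert V (gaugeAct (fun _ => (1 : Rˣ)) V) z ν = 1 := by
  simp [pert, gaugeAct]

/-- [folklore] If the `k`-fold coarse configurations coincide, the top deviation in the trivial top gauge is `0`. -/
theorem top_deviation_eq_zero {L k : ℕ} {U₀ U₁ : Cfg d R} (htop : scaled (L ^ k) U₁ = scaled (L ^ k) U₀) (z : Site d)
    (ν : Fin d) : ‖(pert (scaled (L ^ k) U₀) (gaugeAct (fun _ => (1 : Rˣ)) (scaled (L ^ k) U₁)) z ν : R) - 1‖ ≤ 0 := by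
  rw [htop, pert_gaugeAct_one_self]; simp

/-- [folklore] **THE FIBRE BOUND**: two unitary-like configurations with `FineRegular L k aᵢ Uᵢ` and THE SAME `k`-fold coarse
configuration `scaled (L^k) U₁ = scaled (L^k) U₀` satisfy, in the multilevel relative comb gauge with trivial top gauge,
`‖(U₁^g)(b)·U₀(b)⁻¹ − 1‖ ≤ crossConst d L/(L² − 1)·(a₁ + a₀)` on EVERY bond of `ℤ^d` — for every `k` and every `L ≥ 2`. -/
theorem same_top_bound [NormOneClass R] {L : ℕ} (k : ℕ) {U₀ U₁ : Cfg d R} {a₁ a₀ : ℝ}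
    (hU₀ : ∀ x ν, UnitaryLike (U₀ x ν)) (hU₁ : ∀ x ν, UnitaryLike (U₁ x ν)) (hL : 2 ≤ L)
    (ha₁ : FineRegular L k a₁ U₁) (ha₀ : FineRegular L k a₀ U₀) (htop : scaled (L ^ k) U₁ = scaled (L ^ k) U₀)
    (x : Site d) (ν : Fin d) :
    ‖(pert U₀ (gaugeAct (multiComb (List.replicate k L) (fun _ => 1) U₀ U₁) U₁) x ν : R) - 1‖ ≤
      crossConst d L / ((L : ℝ) ^ 2 - 1) * (a₁ + a₀) := by
  have h := multilevel_bound_regular k hU₀ hU₁ (fun _ => UnitaryLike.one) hL ha₁ ha₀ (top_deviation_eq_zero htop) x ν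
  linarith

/-- [folklore] **THE FIBRE BOUND, `k`- AND `L`-FREE**: same hypotheses, `‖(U₁^g)(b)·U₀(b)⁻¹ − 1‖ ≤ (d−1)(2d−1)·(a₁ + a₀)`. -/
theorem same_top_bound_dconst [NormOneClass R] {L : ℕ} (k : ℕ) {U₀ U₁ : Cfg d R} {a₁ a₀ : ℝ}
    (hU₀ : ∀ x ν, UnitaryLike (U₀ x ν)) (hU₁ : ∀ x ν, UnitaryLike (U₁ x ν)) (hL : 2 ≤ L)
    (ha₁ : FineRegular L k a₁ U₁) (ha₀ : FineRegular L k a₀ U₀) (htop : scaled (L ^ k) U₁ = scaled (L ^ k) U₀)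
    (x : Site d) (ν : Fin d) :
    ‖(pert U₀ (gaugeAct (multiComb (List.replicate k L) (fun _ => 1) U₀ U₁) U₁) x ν : R) - 1‖ ≤
      ((d : ℝ) - 1) * (2 * (d : ℝ) - 1) * (a₁ + a₀) := by
  have h := multilevel_bound_regular_dconst k hU₀ hU₁ (fun _ => UnitaryLike.one) hL ha₁ ha₀
    (top_deviation_eq_zero htop) x ν
  linarith

/-! ## §5  Non-vacuity / sanity -/

/-- The constant in `d = 4`: `(d−1)(2d−1) = 21`, and `2·21 = 42 ≤ 64 = 4d²`. -/
example : ((4 : ℝ) - 1) * (2 * (4 : ℝ) - 1) = 21 ∧ 2 * (21 : ℝ) ≤ 4 * (4 : ℝ) ^ 2 := by norm_num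

/-- The constant for `d = 4`, `L = 2`: `crossConst 4 2 = 3·7 = 21`, `crossConst 4 2/(2² − 1) = 7 ≤ 21`. -/
example : crossConst 4 2 = 21 ∧ crossConst 4 2 / ((2 : ℝ) ^ 2 - 1) = 7 := by
  unfold crossConst; norm_num

/-- Three levels, `L = 2`: the `Σ` form's coefficient is `crossConst d 2·(1 + 4 + 16)`. -/
example (d : ℕ) (q : ℝ) :
    scaleSum d (List.replicate 3 2) (fun j => (((2 : ℕ) : ℝ) ^ j) ^ 2 * q) = crossConst d 2 * (21 * q) := by
  rw [scaleSum_replicate, Finset.sum_range_succ, Finset.sum_range_succ, Finset.sum_range_succ, Finset.sum_range_zero]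
  push_cast
  ring

/-- The flat configuration `1` is `FineRegular L k 0` and `LevelRegular L k 0` (every straight transport of `1` is `1`). -/
example [NormOneClass R] (L k : ℕ) : FineRegular L k 0 (fun _ _ => (1 : Rˣ) : Cfg d R) := by
  intro x ρ κ _; simp [plaq]

example [NormOneClass R] (L k : ℕ) : LevelRegular L k 0 (fun _ _ => (1 : Rˣ) : Cfg d R) := by
  intro j _ x ρ κ _
  have hflat : scaled (L ^ j) (fun _ _ => (1 : Rˣ)) = (fun _ _ => (1 : Rˣ) : Cfg d R) := by
    funext y μ; exact hol_line_eq_one (L ^ j) (fun _ _ => rfl)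
  rw [hflat]; simp [plaq]

/-- Non-vacuity of the fibre bound: the flat pair `U₀ = U₁ = 1` satisfies every hypothesis (`a₁ = a₀ = 0`, same coarse
configuration trivially) and the conclusion is the true statement `0 ≤ 0`. -/
example [NormOneClass R] {L : ℕ} (hL : 2 ≤ L) (k : ℕ) (x : Site d) (ν : Fin d) :
    ‖(pert (fun _ _ => (1 : Rˣ)) (gaugeAct (multiComb (List.replicate k L) (fun _ => 1) (fun _ _ => 1) (fun _ _ => 1))
      (fun _ _ => (1 : Rˣ))) x ν : R) - 1‖ ≤ crossConst d L / ((L : ℝ) ^ 2 - 1) * (0 + 0) := by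
  have h1 : ∀ (x : Site d) (ν : Fin d), UnitaryLike ((fun _ _ => (1 : Rˣ)) x ν) := fun _ _ => UnitaryLike.one
  have hreg : FineRegular L k 0 (fun _ _ => (1 : Rˣ) : Cfg d R) := by intro x ρ κ _; simp [plaq]
  exact same_top_bound k h1 h1 hL hreg hreg rfl x ν

/-- The `k`-uniformity made visible: for the flat reference `U₀ = 1` and ANY unitary-like `U₁` with `‖U₁(∂p) − 1‖ ≤ a·η²`
whose `k`-fold straight transports are all `1`, the multilevel comb gauge brings EVERY bond variable of `U₁` within
`(d−1)(2d−1)·a` of `1`, whatever `k` is. -/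
example [NormOneClass R] {L : ℕ} (hL : 2 ≤ L) (k : ℕ) {U₁ : Cfg d R} {a : ℝ} (hU₁ : ∀ x ν, UnitaryLike (U₁ x ν))
    (ha : FineRegular L k a U₁) (htop : scaled (L ^ k) U₁ = fun _ _ => 1) (x : Site d) (ν : Fin d) :
    ‖(gaugeAct (multiComb (List.replicate k L) (fun _ => 1) (fun _ _ => 1) U₁) U₁ x ν : R) - 1‖ ≤
      ((d : ℝ) - 1) * (2 * (d : ℝ) - 1) * (a + 0) := by
  have h1 : ∀ (x : Site d) (ν : Fin d), UnitaryLike ((fun _ _ => (1 : Rˣ)) x ν) := fun _ _ => UnitaryLike.one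
  have hreg : FineRegular L k 0 (fun _ _ => (1 : Rˣ) : Cfg d R) := by intro x ρ κ _; simp [plaq]
  have hflat : scaled (L ^ k) (fun _ _ => (1 : Rˣ)) = (fun _ _ => (1 : Rˣ) : Cfg d R) := by
    funext y μ; exact hol_line_eq_one (L ^ k) (fun _ _ => rfl)
  have h := same_top_bound_dconst k h1 hU₁ hL ha hreg (htop.trans hflat.symm) x ν
  simpa [pert] using h

end Literature.MathematicalPhysics.QuantumFieldTheory.Balaban1983to89.T4MultilevelCombRegular
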